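import Literature.Geometry.Riemannian.AlmostNonnegRicciFibrationLimitCore
import HarnessLib

/-!
# Huang–Huang–Wang–Zhu 2026, Main Theorem 1 at `n = 4`, `b₁ = 1`: the two remaining inputs as
# named facts (volume comparison; the analysis of the equivariant limit), and the assembly

Eleventh file for the named fact
`Literature.Geometry.Riemannian.huangHuangWangZhu2026_fibresOverCircle_four`
(`AlmostNonnegRicciFibration.lean`; H. Huang, X.-T. Huang, J. Wang, X. Zhu, arXiv:2605.24380
(2026), Main Theorem 1, specialised to closed smooth 4-manifolds `P ≃ₕ S¹ × S³`). Fact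
decomposition (librarian, 2026-08-16).

The ten reduction files of this directory PROVE the whole topological and metric skeleton of the
printed proof (§4 pp. 13–14): homotopy equivalence ⇒ circle map of winding number one ⇒ smooth
circle map (Whitney) ⇒ connected infinite cyclic cover `P̂` with its lifted complete proper
geodesic metric, free properly discontinuous cocompact isometric deck action and lines
(`…CoverReduction`, `CyclicCover*`), the descent of an equivariant function without critical
points to a smooth submersion with connected fibres (`…Reduction`, `EquivariantCircleDescent`),
the contradiction sequence (`…Sequential`: `CoreDatum`, `CoreDatum.Good`), and — GIVEN uniform
covering bounds for the balls of the covers — the pointed equivariant Gromov–Hausdorff limit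
`(M̂ᵢ, p̂ᵢ, Hᵢ) → (Y, y, H)` of diagram (4.1) with `Y` proper geodesic noncompact containing a
line and `H` abelian cocompact (`…Precompact`, `…Limit*`, `…EquivLimit`,
`CoreDatum.UniformlyCoveredBalls.limit_package`). The end form
`huangHuangWangZhu2026_fibresOverCircle_four_of_volumeComparison_of_limitCore`
(`AlmostNonnegRicciFibrationLimitCore.lean`) leaves exactly two hypotheses, named here (D-0014
named facts):

* `Gromov1981_cyclicCovers_uniformlyCoveredBalls` — (BG) **volume comparison**: the complete
  covers `M̂ᵢ` (dimension `4`, `Ric ≥ -δᵢ ĝᵢ`, `δᵢ ≤ 1`) of every contradiction sequence have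
  uniformly covered balls — Bishop–Gromov relative volume comparison / Gromov's precompactness
  theorem ("by volume comparison", §2.1 Thm 2.1 of the source; Petersen, *Riemannian Geometry*,
  Ch. 9);
* `HuangHuangWangZhu2026_limitCore_four` — (LIM) **the analysis of the equivariant limit**: along
  every contradiction sequence (`δᵢ ↓ 0`) whose covers have uniformly covered balls, some datum is
  good (admits a deck-equivariant smooth function without critical points on its cover) — the
  Cheeger–Colding almost splitting `Y = ℝ × Ŷ`, Thm 1.11 (equivariant smooth almost submersions)
  and Thm 2.9 (non-degeneracy of `dF` from `sec ≥ -κ`) of the source, §4 pp. 13–14. This is the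
  analytic heart of Main Theorem 1 and only that: Bishop–Gromov and every topological step are
  excluded (theorems of the tree or the fact (BG));
* `huangHuangWangZhu2026_fibresOverCircle_four_holds_of` — the assembly (one line).

STATUS CAVEAT (as in `AlmostNonnegRicciFibration.lean`): the source is a May-2026 arXiv preprint.

## References

* H. Huang, X.-T. Huang, J. Wang, X. Zhu, arXiv:2605.24380 (2026), Main Theorem 1 (p. 3), Thm 1.11
  (pp. 4–5), §2.1 Thm 2.1 (p. 6), Thm 2.9, §4 pp. 13–14. [HuangHuangWangZhu2026]
* P. Petersen, *Riemannian Geometry*, GTM 171, 2nd ed. (2006), Ch. 9 (§1 relative volume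
  comparison, Lemma 36; Cor. "Gromov's precompactness"). [Petersen2006]
* J. Cheeger, T. H. Colding, J. Differential Geom. 46 (1997) (almost splitting). [CheegerColding1997]
-/

noncomputable section

open scoped Manifold ContDiff Topology
open Function Set Filter Metric

namespace Literature.Geometry.Riemannian

open Literature.Geometry.MetricGeometry Literature.Topology.FourManifolds.CircleMaps

/-- **(BG) Volume comparison for the covers of a contradiction sequence** (Huang–Huang–Wang–Zhu
2026, §2.1 p. 6, Thm 2.1 and §4 p. 13: "by volume comparison" the pointed covers `(M̂ᵢ, p̂ᵢ)`
subconverge — Gromov's precompactness theorem for complete Riemannian `n`-manifolds with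
`Ric ≥ -(n-1)k`, from the Bishop–Gromov relative volume comparison
`vol B(p, R)/vol B(p, r) ≤ v(n, k, R)/v(n, k, r)`: every ball `B̄(p, R)` contains an `ε`-net of
cardinality `≤ N(n, k, R, ε)` [Petersen, Ch. 9, §1 Lemma 36 and the precompactness corollary]).
In the tree's rendering: for every `κ`, every sequence `δ` with `0 < δᵢ ≤ 1` and every sequence of
data `Dᵢ : CoreDatum κ δᵢ` (closed smooth `Pᵢ ≃ₕ S¹ × S³` with `diam ≤ 1`, `sec ≥ -κ`,
`Ric ≥ -δᵢ gᵢ`, and a smooth circle map with connected infinite cyclic cover), the covers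
`M̂ᵢ = CyclicCover (Dᵢ).f₀` with their lifted (complete, proper, geodesic) metrics and any base
points `p̂ᵢ` have UNIFORMLY COVERED BALLS (`CoreDatum.UniformlyCoveredBalls`: for all `R`, `ε > 0`
there is `N` with an `ε`-dense subset of `B̄(p̂ᵢ, R)` of cardinality `≤ N` for every `i`) — the
lifted metrics have `Ric ≥ -δᵢ ĝᵢ ≥ -ĝᵢ` in dimension `4` (`CyclicCoverCurvature.lean`), so one
bound `N(4, 1/3, R, ε)` serves all `i`. Hypothesis `hBG` of
`huangHuangWangZhu2026_fibresOverCircle_four_of_volumeComparison_of_limitCore`. [cite: Petersen2006, Ch. 9 §1 (relative volume comparison, Lemma 36) and Gromov's precompactness corollary] [cite: HuangHuangWangZhu2026, §2.1 p. 6 Thm 2.1 and §4 p. 13] -/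
def Gromov1981_cyclicCovers_uniformlyCoveredBalls : Prop :=
  ∀ (κ : ℝ) (δ : ℕ → ℝ) (D : (i : ℕ) → CoreDatum κ (δ i)) (p : ∀ i, (D i).Cover),
    0 < κ → (∀ i, 0 < δ i) → (∀ i, δ i ≤ 1) → CoreDatum.UniformlyCoveredBalls D p

/-- **(LIM) The analysis of the equivariant limit** (Huang–Huang–Wang–Zhu 2026, §4 pp. 13–14, the
proof of Main Theorem 1 after diagram (4.1), at `n = 4`, `b = s = 1`): "we apply Theorem 1.11
[equivariant smooth maps `Fᵢ : M̂ᵢ → ℝˢ`, `εᵢ`-close to the splitting coordinate of the limit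
`ℝˢ × Ŷ`, `Kᵢ`-equivariant] … and obtain that `dFᵢ` is non-degenerate due to the lower bound on
sectional curvature [Thm 2.9; Huang–Huang 2024, Cor. 7.6]", the limit `Y = ℝ × Ŷ` coming from the
Cheeger–Colding almost splitting theorem applied to the line of `Y`. In the tree's rendering: for
every `κ > 0`, every sequence `0 < δᵢ ≤ 1` with `δᵢ → 0`, every contradiction sequence
`Dᵢ : CoreDatum κ δᵢ` and base points `p̂ᵢ` whose covers have uniformly covered balls
(`CoreDatum.UniformlyCoveredBalls D p̂`, which by `CoreDatum.UniformlyCoveredBalls.limit_package`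
supplies the proper geodesic noncompact equivariant limit `(Y, y, H)` with a line and `H` abelian,
cocompact at scale `1`), SOME datum `Dᵢ` is good (`CoreDatum.Good`: a smooth function on the cover
`M̂ᵢ`, equivariant under the generator of the deck group, `F(1 +ᵥ x̂) = F x̂ + c`, without critical
points). Only the analytic heart of the theorem: volume comparison is the separate fact
`Gromov1981_cyclicCovers_uniformlyCoveredBalls`, and every topological step (homotopy equivalence
⇒ winding-one circle map ⇒ connected cyclic cover; descent of `F` to a submersion with connected
fibres) is a theorem of the tree. Hypothesis `hLIM` of
`huangHuangWangZhu2026_fibresOverCircle_four_of_volumeComparison_of_limitCore`. Preprint (May 2026).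
[cite: HuangHuangWangZhu2026, §4 pp. 13–14 (proof of Main Theorem 1 after (4.1)), Thm 1.11 and Thm 2.9] [cite: CheegerColding1997, splitting of Ricci-limit spaces containing a line (as invoked in HuangHuangWangZhu2026 §4)] -/
def HuangHuangWangZhu2026_limitCore_four : Prop :=
  ∀ κ : ℝ, 0 < κ → ∀ δ : ℕ → ℝ, (∀ i, 0 < δ i) → (∀ i, δ i ≤ 1) →
    Tendsto δ atTop (𝓝 0) → ∀ (D : (i : ℕ) → CoreDatum κ (δ i)) (p : ∀ i, (D i).Cover),
      CoreDatum.UniformlyCoveredBalls D p → ∃ i, (D i).Good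

/-- **Assembly of Huang–Huang–Wang–Zhu 2026, Main Theorem 1 (`n = 4`, `b₁ = 1`)**: the named fact
`huangHuangWangZhu2026_fibresOverCircle_four` follows from volume comparison (BG) and the analysis of
the equivariant limit (LIM) — by
`huangHuangWangZhu2026_fibresOverCircle_four_of_volumeComparison_of_limitCore`, i.e. the
contradiction argument of §4 with the whole topological and metric skeleton proved in the tree.
[cite: HuangHuangWangZhu2026, Main Theorem 1 (p. 3) and §4 pp. 13–14] -/
theorem huangHuangWangZhu2026_fibresOverCircle_four_holds_of
    (hBG : Gromov1981_cyclicCovers_uniformlyCoveredBalls)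
    (hLIM : HuangHuangWangZhu2026_limitCore_four) :
    huangHuangWangZhu2026_fibresOverCircle_four :=
  huangHuangWangZhu2026_fibresOverCircle_four_of_volumeComparison_of_limitCore hBG hLIM

end Literature.Geometry.Riemannian

end
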